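import Literature.Probability.RandomPlanarGeometry.SAWBridgeRenewalLimit
import Literature.Probability.RandomPlanarGeometry.SAWKestenRelation
import Literature.Probability.RandomPlanarGeometry.SAWBridgeNoRenewal
import Literature.Probability.Process.EricksonRenewalBounds
import Mathlib.Analysis.Asymptotics.SpecificAsymptotics
import HarnessLib

/-!
# Kesten's bridge renewal under Erickson's sandwich: `N + 1 ≤ U_N · m_N ≤ 2N + 1` on every `ℤ^d`

Topic `Literature/Probability/RandomPlanarGeometry` (self-avoiding walk on `ℤ^d`, the bridge renewal
structure of Kesten 1963 / Madras–Slade §4.2). Sources: N. Madras, G. Slade, *The Self-Avoiding Walk*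
(1993), §4.2, eqs. (4.2.4) `Σ_N λ_N μ^{-N} = 1` and (4.2.5) `a_N = Σ_{k≤N} p_k a_{N-k}` with `a_N = b_N μ^{-N}`,
`p_k = λ_k μ^{-k}` (p. 91); K. B. Erickson, *The strong law of large numbers when the mean is undefined*,
Trans. Amer. Math. Soc. 185 (1973), 371–381, Lemma 1 (as quoted by R. Doney et al., arXiv:1303.4715, p. 5:
"Without any assumptions, for every `x ≥ 0`, `x / E min{χ, x} ≤ H([0,x]) ≤ 2x / E min{χ, x}`"), whose
discrete form is the tree theorem `Renewal.erickson_lower` / `Renewal.erickson_upper`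
(`Literature/Probability/Process/EricksonRenewalBounds.lean`); H. Duminil-Copin, A. Hammond,
*Self-avoiding walk is sub-ballistic*, Comm. Math. Phys. 324 (2013), Lemma 2.2 (Kesten's irreducible-bridge
law `P_iSAB(γ) = μ^{-|γ|}`) and Theorem 2.5 (`E_iSAB|γ| = ∞`, tree theorem `DuminilCopinHammond2013_thm2_5_holds`).

Write `U_N := Σ_{n≤N} b_n μ^{-n}` (the critical bridge mass up to length `N`, the renewal measure of `[0,N]`)
and `m_N := Σ_{j≤N} P_iSAB(|γ| > j) = Σ_{j≤N} (1 − Σ_{k≤j} λ_k μ^{-k}) = E_iSAB[min(|γ|, N+1)]` (the truncated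
mean length of a Kesten-irreducible bridge). Pointing Erickson's lemma at Kesten's renewal (4.2.5) gives, for
EVERY `d ≥ 1` and EVERY `N`,

  **`N + 1 ≤ U_N · m_N ≤ 2N + 1`** (`kestenErickson_sandwich`),

an exact two-sided coupling between the decay of `b_n μ^{-n}` (DCH Theorem 2.5: `→ 0` for `d ≥ 2`, no rate in
print) and the growth of the truncated irreducible length: any explicit rate for one is an explicit rate for
the other up to the factor `2` (`bridgeLenMass_le_of_irrLenTail_ge`, `sum_irrLenTail_ge_of_bridgeLenMass_le`); in
particular `m_N → ∞` at least at the Cesàro rate of `b_n μ^{-n} → 0` (`tendsto_sum_irrLenTail_atTop`, `d ≥ 2`).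

Printed status: Erickson's Lemma 1 is general renewal theory; its instance for the SAW bridge renewal is not
in print (Madras–Slade §4.2 has (4.2.4) and `b_n μ^{-n} → 1/E|γ|`; DCH 2013 Theorem 2.5 is qualitative) —
lane «pcv-sawmu» route R59 (a-idea-1 ROUTES-G11 §R59), statements `stub_R59_kestenErickson` /
`stub_R59_rate_transfer` of the lane's Sketch_G11 verbatim in shape.
-/

noncomputable section

open Finset

namespace Literature.Probability.RandomPlanarGeometry.SAW.Zd

/-- `P_iSAB(|γ| > j) = 1 − Σ_{k≤j} λ_k μ^{-k}`, the length tail of Kesten's irreducible-bridge law.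
[cite: MadrasSlade1993, §4.2 (4.2.4); DuminilCopinHammond2013, Lemma 2.2] -/
def irrLenTail (d : ℕ) [NeZero d] (j : ℕ) : ℝ :=
  1 - ∑ k ∈ Finset.range (j + 1), (irreducibleBridgeCount d k : ℝ) / connectiveConstant d ^ k

/-- `U_N = Σ_{n≤N} b_n μ^{-n}`, the critical bridge mass up to length `N`. [cite: MadrasSlade1993, §4.2 (p. 91)] -/
def bridgeLenMass (d : ℕ) [NeZero d] (N : ℕ) : ℝ :=
  ∑ n ∈ Finset.range (N + 1), (bridgeCount d n : ℝ) / connectiveConstant d ^ n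

variable (d : ℕ) [NeZero d]

/-- `P_iSAB(|γ| > j) ≥ 0`, i.e. Kesten's inequality (4.2.4) `Σ_{k≤j} λ_k μ^{-k} ≤ 1`.
[cite: MadrasSlade1993, §4.2, eq. (4.2.4)] -/
theorem irrLenTail_nonneg (j : ℕ) : 0 ≤ irrLenTail d j :=
  sub_nonneg.2 (sum_irreducibleBridgeCount_div_pow_le_one d _)

/-- `P_iSAB(|γ| > j) ≤ 1`. [cite: MadrasSlade1993, §4.2, eq. (4.2.4)] -/
theorem irrLenTail_le_one (j : ℕ) : irrLenTail d j ≤ 1 :=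
  sub_le_self _ (sum_nonneg fun k _ => irreducibleBridgeCount_div_pow_nonneg d k)

/-- `U_N ≥ 1` (the empty bridge: `b₀ μ⁰ = 1`). [cite: MadrasSlade1993, §4.2 (p. 91)] -/
theorem one_le_bridgeLenMass (N : ℕ) : 1 ≤ bridgeLenMass d N := by
  unfold bridgeLenMass
  rw [sum_range_succ', bridgeCount_div_pow_zero]
  exact le_add_of_nonneg_left (sum_nonneg fun n _ => bridgeCount_div_pow_nonneg d _)

/-- `U_N ≤ N + 1` (`b_n ≤ μⁿ`, Madras–Slade (1.2.17)). [cite: MadrasSlade1993, (1.2.17) and §4.2] -/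
theorem bridgeLenMass_le (N : ℕ) : bridgeLenMass d N ≤ (N : ℝ) + 1 := by
  unfold bridgeLenMass
  calc ∑ n ∈ Finset.range (N + 1), (bridgeCount d n : ℝ) / connectiveConstant d ^ n
      ≤ ∑ _n ∈ Finset.range (N + 1), (1 : ℝ) := sum_le_sum fun n _ => bridgeCount_div_pow_le_one d n
    _ = (N : ℝ) + 1 := by simp

/-- **Kesten–Erickson sandwich** on every `ℤ^d`: for every `N`,
`N + 1 ≤ U_N · m_N ≤ 2(N+1)`, `U_N = Σ_{n≤N} b_n μ^{-n}`, `m_N = Σ_{j≤N} P_iSAB(|γ| > j) = E_iSAB[min(|γ|, N+1)]`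
— Erickson's Lemma 1 for the renewal sequence `a_N = b_N μ^{-N}` with step law `p_k = λ_k μ^{-k}`
(Madras–Slade (4.2.5)); the upper half in the sharper form `2N + 1` is `kestenErickson_upper`.
[cite: Erickson1973, Lemma 1; MadrasSlade1993, §4.2, eqs. (4.2.4)–(4.2.5)] -/
theorem kestenErickson_sandwich (N : ℕ) :
    (N : ℝ) + 1 ≤ bridgeLenMass d N * ∑ j ∈ Finset.range (N + 1), irrLenTail d j ∧
      bridgeLenMass d N * ∑ j ∈ Finset.range (N + 1), irrLenTail d j ≤ 2 * ((N : ℝ) + 1) := by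
  have hr : ∀ n, irrLenTail d n =
      1 - ∑ k ∈ Finset.range (n + 1), (irreducibleBridgeCount d k : ℝ) / connectiveConstant d ^ k :=
    fun n => rfl
  have hu0 := bridgeCount_div_pow_zero d
  have hf0 := irreducibleBridgeCount_div_pow_zero d
  have hren : ∀ n, 1 ≤ n → (bridgeCount d n : ℝ) / connectiveConstant d ^ n =
      ∑ k ∈ Finset.range (n + 1), (irreducibleBridgeCount d k : ℝ) / connectiveConstant d ^ k *
        ((bridgeCount d (n - k) : ℝ) / connectiveConstant d ^ (n - k)) :=
    fun n hn => MadrasSlade1993_eq425 d hn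
  have hu := bridgeCount_div_pow_nonneg d
  have hrnn := irrLenTail_nonneg d
  refine ⟨?_, ?_⟩
  · exact _root_.Literature.Probability.Process.Renewal.erickson_lower hr hu0 hf0 hren hu hrnn N
  · have h := _root_.Literature.Probability.Process.Renewal.erickson_upper hr hu0 hf0 hren hu hrnn N
    unfold bridgeLenMass
    linarith

/-- The upper half in Erickson's sharper form: `U_N · m_N ≤ 2N + 1`. [cite: Erickson1973, Lemma 1] -/
theorem kestenErickson_upper (N : ℕ) :
    bridgeLenMass d N * ∑ j ∈ Finset.range (N + 1), irrLenTail d j ≤ 2 * (N : ℝ) + 1 := by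
  have hr : ∀ n, irrLenTail d n =
      1 - ∑ k ∈ Finset.range (n + 1), (irreducibleBridgeCount d k : ℝ) / connectiveConstant d ^ k :=
    fun n => rfl
  have hren : ∀ n, 1 ≤ n → (bridgeCount d n : ℝ) / connectiveConstant d ^ n =
      ∑ k ∈ Finset.range (n + 1), (irreducibleBridgeCount d k : ℝ) / connectiveConstant d ^ k *
        ((bridgeCount d (n - k) : ℝ) / connectiveConstant d ^ (n - k)) :=
    fun n hn => MadrasSlade1993_eq425 d hn
  exact _root_.Literature.Probability.Process.Renewal.erickson_upper hr (bridgeCount_div_pow_zero d)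
    (irreducibleBridgeCount_div_pow_zero d) hren (bridgeCount_div_pow_nonneg d) (irrLenTail_nonneg d) N

/-- **Rate transfer, bridges ⇐ lengths**: a lower envelope `g N ≤ m_N` for the truncated irreducible length
gives `U_N ≤ 2(N+1)/g N`, i.e. an explicit Cesàro rate for `b_n μ^{-n} → 0`.
[cite: Erickson1973, Lemma 1; DuminilCopinHammond2013, Theorem 2.5] -/
theorem bridgeLenMass_le_of_irrLenTail_ge {g : ℕ → ℝ} (hg : ∀ N, 0 < g N)
    (hm : ∀ N, g N ≤ ∑ j ∈ Finset.range (N + 1), irrLenTail d j) (N : ℕ) :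
    bridgeLenMass d N ≤ 2 * ((N : ℝ) + 1) / g N := by
  rw [le_div_iff₀ (hg N)]
  have h2 := (kestenErickson_sandwich d N).2
  have hU : 0 ≤ bridgeLenMass d N := (zero_le_one.trans (one_le_bridgeLenMass d N))
  calc bridgeLenMass d N * g N ≤ bridgeLenMass d N * ∑ j ∈ Finset.range (N + 1), irrLenTail d j :=
        mul_le_mul_of_nonneg_left (hm N) hU
    _ ≤ 2 * ((N : ℝ) + 1) := h2

/-- **Rate transfer, lengths ⇐ bridges**: an upper envelope `U_N ≤ G N` for the critical bridge mass gives
`m_N ≥ (N+1)/G N`, i.e. an explicit growth rate for the truncated mean irreducible length.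
[cite: Erickson1973, Lemma 1; DuminilCopinHammond2013, Theorem 2.5] -/
theorem sum_irrLenTail_ge_of_bridgeLenMass_le {G : ℕ → ℝ}
    (hU : ∀ N, bridgeLenMass d N ≤ G N) (N : ℕ) :
    ((N : ℝ) + 1) / G N ≤ ∑ j ∈ Finset.range (N + 1), irrLenTail d j := by
  have hG : 0 < G N := lt_of_lt_of_le (zero_lt_one.trans_le (one_le_bridgeLenMass d N)) (hU N)
  rw [div_le_iff₀ hG]
  have h1 := (kestenErickson_sandwich d N).1
  have hm : 0 ≤ ∑ j ∈ Finset.range (N + 1), irrLenTail d j := sum_nonneg fun j _ => irrLenTail_nonneg d j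
  calc (N : ℝ) + 1 ≤ bridgeLenMass d N * ∑ j ∈ Finset.range (N + 1), irrLenTail d j := h1
    _ ≤ G N * ∑ j ∈ Finset.range (N + 1), irrLenTail d j := mul_le_mul_of_nonneg_right (hU N) hm
    _ = (∑ j ∈ Finset.range (N + 1), irrLenTail d j) * G N := mul_comm _ _

/-- In particular (take `G N = N + 1`): `m_N ≥ 1`, and (take the trivial `m_N ≤ N + 1`): `U_N ≥ 1` — the two
trivial envelopes are consistent with the sandwich; the content is in between. The useful unconditional
consequence: **`m_N ≥ (N+1)/U_N`** with `U_N` the partial sums of a sequence tending to `0` (`d ≥ 2`, DCH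
Theorem 2.5), so `m_N → ∞` at exactly the Cesàro rate of `b_n μ^{-n} → 0`.
[cite: DuminilCopinHammond2013, Theorem 2.5] -/
theorem sum_irrLenTail_ge (N : ℕ) :
    ((N : ℝ) + 1) / bridgeLenMass d N ≤ ∑ j ∈ Finset.range (N + 1), irrLenTail d j :=
  sum_irrLenTail_ge_of_bridgeLenMass_le d (fun _ => le_rfl) N

/-- `U_N/(N+1) → 0` on `ℤ^d`, `d ≥ 2`: the Cesàro form of Duminil-Copin–Hammond's Theorem 2.5 `b_N μ^{-N} → 0`
(tree theorem `tendsto_bridgeCount_div_pow_zero`). [cite: DuminilCopinHammond2013, Theorem 2.5] -/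
theorem tendsto_bridgeLenMass_div (hd : 2 ≤ d) :
    Filter.Tendsto (fun N : ℕ => bridgeLenMass d N / ((N : ℝ) + 1)) Filter.atTop (nhds 0) := by
  have h := ((tendsto_bridgeCount_div_pow_zero d hd).cesaro).comp (Filter.tendsto_add_atTop_nat 1)
  refine h.congr fun N => ?_
  simp only [Function.comp_apply, bridgeLenMass, Nat.cast_add, Nat.cast_one]
  rw [div_eq_inv_mul]

/-- **The truncated mean length of a Kesten-irreducible bridge diverges** on `ℤ^d`, `d ≥ 2`:
`m_N = Σ_{j≤N} P_iSAB(|γ| > j) → ∞`, at least at the Cesàro rate of `b_n μ^{-n} → 0` (`m_N ≥ (N+1)/U_N`) — the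
quantitative coupling form of `E_iSAB|γ| = ∞`. [cite: DuminilCopinHammond2013, Theorem 2.5; Erickson1973, Lemma 1] -/
theorem tendsto_sum_irrLenTail_atTop (hd : 2 ≤ d) :
    Filter.Tendsto (fun N : ℕ => ∑ j ∈ Finset.range (N + 1), irrLenTail d j) Filter.atTop Filter.atTop := by
  -- `(N+1)/U_N → ∞` since `U_N/(N+1) → 0⁺`
  have hpos : ∀ N : ℕ, 0 < bridgeLenMass d N / ((N : ℝ) + 1) := fun N =>
    div_pos (zero_lt_one.trans_le (one_le_bridgeLenMass d N)) (by positivity)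
  have h0 : Filter.Tendsto (fun N : ℕ => bridgeLenMass d N / ((N : ℝ) + 1)) Filter.atTop
      (nhdsWithin 0 (Set.Ioi 0)) :=
    tendsto_nhdsWithin_of_tendsto_nhds_of_eventually_within _ (tendsto_bridgeLenMass_div d hd)
      (Filter.Eventually.of_forall fun N => hpos N)
  have hinv := tendsto_inv_nhdsGT_zero.comp h0
  refine Filter.tendsto_atTop_mono (fun N => ?_) hinv
  have e : (bridgeLenMass d N / ((N : ℝ) + 1))⁻¹ = ((N : ℝ) + 1) / bridgeLenMass d N := by
    rw [inv_div]
  simp only [Function.comp_apply]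
  rw [e]
  exact sum_irrLenTail_ge d N

end Literature.Probability.RandomPlanarGeometry.SAW.Zd

end
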